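/- Free-seat work of EXTRA WIDTH SEAT `ym-line-cbag-p1-w5` (prover-ym-line-cbag-p1-w5-g10-0), route `EguchiKawaiDirectionLadder`
(ideator ym-idea-2, LINE 8): post-closure glue for the barrier entry `EguchiKawaiBreakdown` (crux stmt-QuantumFields-27724,
CLOSED·proved); w5's lane (3) «`d = 2` centre symmetry at every coupling» (LEAD ym-line-cbag-p1 g26/g27).  ROUTE-INDEPENDENT in
content (only the `d = 2` engine `TwoDim.*` of `…TwoDimSymmetric.lean` and `Literature` are used).  HONEST FRAMING: theorems about
SINGLE-SITE unitary matrix integrals in `d = 2`; nothing here bears on the Yang–Mills mass gap (no summit statement, no continuum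
limit, no large-`N` reduction of any lattice theory is proved or advanced). -/
import Summits.QuantumFields.YangMills.Theorems.EguchiKawaiDirectionLadderTwoDimSymmetric
import HarnessLib

/-!
# Route `EguchiKawaiDirectionLadder`: in `d = 2` NO plaquette-determined single-site action breaks the centre symmetry

`EguchiKawaiDirectionLadderTwoDimSymmetric.lean` proved `⟨|(1/N) tr U_μ|²⟩ ≤ 1/N` for the Wilson-type reduced weight (14.40) in
`d = 2` at every coupling.  The argument used only two properties of the weight `w(A, V) = e^{−N² b S_R[A,V]}`: continuity /
non-negativity, and `w(A, D V) = w(A, V)` whenever `D` commutes with `A`.  Here the same engine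
(`TwoDim.integral_mul_norm_sq_trace_le`) is run for an ARBITRARY weight, giving:

* `TwoDim.integral_normSq_openLine_one_mul_le_of_inv` / `…_zero_…` — for every continuous `w ≥ 0` on `U(N)²` with
  `w(A, DV) = w(A, V)` for all `D` commuting with `A` (resp. `w(DA, V) = w(A, V)` for all `D` commuting with `V`):
  `∫ w |tr U₁/N|² ≤ (1/N) ∫ w` (resp. direction `0`), every `N ≥ 1`;
* `TwoDim.holonomy_pair_mul_left` / `…_right` — the four plaquette holonomies `U_ν⁻¹ U_μ⁻¹ U_ν U_μ` of a pair are UNCHANGED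
  under `V ↦ DV` (`D` commuting with `A`) and under `A ↦ DA` (`D` commuting with `V`); hence every PLAQUETTE-DETERMINED weight
  (`w U = w U'` whenever all holonomies of `U` and `U'` agree) has both invariances;
* `integral_normSq_openLine_mul_le_of_plaquette`, `openLine_ratio_le_of_plaquette` — **for `d = 2`, every `N ≥ 1`, both
  directions and EVERY continuous plaquette-determined weight `w ≥ 0`: `∫ w |tr U_μ/N|² ≤ (1/N) ∫ w`**, i.e. the open-line order
  parameter of ANY one-plaquette single-site action (Wilson at any real coupling, twisted, adjoint / mixed fundamental–adjoint,
  heat-kernel, Manton, …) is `≤ 1/N`;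
* `tekAction_eq_of_holonomy_eq`, `tek_integral_normSq_openLine_mul_le`, `tekOrderParameter_two_le`,
  `tekOpenLines_tendsto_zero_two` — in particular for the TWISTED Eguchi–Kawai action `tekAction z` of González-Arroyo–Okawa
  (evasion (b) of the barrier entry) with ANY twist matrix `z` (not necessarily of modulus one, possibly `N`-dependent, as the
  symmetric twist `z_{μν} = e^{2πik/L}`, `N = L²`, is) and ANY real coupling (possibly `N`-dependent): the `d = 2` order parameter
  is `≤ 1/N` and tends to `0`.  In two dimensions the twist is therefore IDLE for the centre symmetry: twisted and untwisted
  reductions can differ only for `d ≥ 3` — consistent with the printed picture (Makeenko §14.4, PDF p. 250: the naive reduction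
  "is valid, strictly speaking, only in `d = 2`"; §15.3: the twist is introduced to save the symmetry at weak coupling in `d = 4`).

Proof: verbatim the `d = 2` mechanism of `…TwoDimSymmetric.lean` — for fixed first link `A = PΛP⁻¹` the conjugate sign flips
`D_i = P S_i P⁻¹` commute with `A`, Haar LEFT invariance under `V ↦ D_i V` kills the weighted cross moments of the diagonal of
`P⁻¹VP`, `|a_ii| ≤ 1`, Fubini over `A`; direction `0` by relabelling the two directions (`measurePreserving_relabelEquiv`).
References: Y. Makeenko, *Methods of Contemporary Gauge Theory*, §14.3–§14.5, §15.3; A. González-Arroyo, M. Okawa,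
JHEP 07 (2010) 043, §2 eq. (1)–(3) (the twisted reduced action, `tekAction`).
-/

set_option autoImplicit false

noncomputable section

open MeasureTheory Filter Topology
open scoped Matrix ComplexConjugate
open Literature.Barriers.QuantumFields
open Literature.LinearAlgebra.Matrix (diagonalTorus exists_conj_mem_diagonalTorus)

namespace Summit.QuantumFields.YangMills.Theorems.EguchiKawaiDirectionLadder

namespace TwoDim

variable {N : ℕ}

/-! ### §1  The plaquette holonomies of a pair are blind to commuting left factors -/

/-- **Holonomies under `V ↦ D V`.**  If `D` commutes with `A`, all four plaquette holonomies `U_ν⁻¹ U_μ⁻¹ U_ν U_μ`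
(`μ, ν ∈ {0, 1}`) of the pair `(A, D V)` coincide with those of `(A, V)`: the mixed words carry `V⁻¹ … V` with `A^{∓1}`
between (`V⁻¹ D⁻¹ A⁻¹ D V A = V⁻¹ A⁻¹ V A`, `A⁻¹ V⁻¹ D⁻¹ A D V = A⁻¹ V⁻¹ A V`) and the diagonal words are `1`. -/
theorem holonomy_pair_mul_left (A V D : UN N) (h : D * A = A * D) (μ ν : Fin 2) :
    ((![A, D * V] : EKConfig 2 N) ν)⁻¹ * ((![A, D * V] : EKConfig 2 N) μ)⁻¹ * (![A, D * V] : EKConfig 2 N) ν *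
        (![A, D * V] : EKConfig 2 N) μ =
      ((![A, V] : EKConfig 2 N) ν)⁻¹ * ((![A, V] : EKConfig 2 N) μ)⁻¹ * (![A, V] : EKConfig 2 N) ν *
        (![A, V] : EKConfig 2 N) μ := by
  have h1 : D⁻¹ * A * D = A := by
    rw [mul_assoc, ← h, ← mul_assoc, inv_mul_cancel, one_mul]
  have h2 : D⁻¹ * A⁻¹ * D = A⁻¹ := by
    have : D⁻¹ * A⁻¹ * D = (D⁻¹ * A * D)⁻¹ := by group
    rw [this, h1]
  revert μ ν
  simp only [Fin.forall_fin_two, Matrix.cons_val_zero, Matrix.cons_val_one]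
  refine ⟨⟨trivial, ?_⟩, ?_, ?_⟩
  · calc (D * V)⁻¹ * A⁻¹ * (D * V) * A = V⁻¹ * (D⁻¹ * A⁻¹ * D) * V * A := by group
      _ = V⁻¹ * A⁻¹ * V * A := by rw [h2]
  · calc A⁻¹ * (D * V)⁻¹ * A * (D * V) = A⁻¹ * V⁻¹ * (D⁻¹ * A * D) * V := by group
      _ = A⁻¹ * V⁻¹ * A * V := by rw [h1]
  · group

/-- Relabelling the two directions swaps the pair: `relabel (swap 0 1) (A, V) = (V, A)`. -/
theorem relabel_swap_pair (A V : UN N) :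
    relabel (Equiv.swap (0 : Fin 2) 1) (![A, V] : EKConfig 2 N) = (![V, A] : EKConfig 2 N) := by
  funext i
  revert i
  simp [Fin.forall_fin_two, relabel]

/-- **Holonomies under `A ↦ D A`.**  If `D` commutes with `V`, all four plaquette holonomies of `(D A, V)` coincide with
those of `(A, V)` (the previous lemma with the two directions exchanged). -/
theorem holonomy_pair_mul_right (A V D : UN N) (h : D * V = V * D) (μ ν : Fin 2) :
    ((![D * A, V] : EKConfig 2 N) ν)⁻¹ * ((![D * A, V] : EKConfig 2 N) μ)⁻¹ * (![D * A, V] : EKConfig 2 N) ν *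
        (![D * A, V] : EKConfig 2 N) μ =
      ((![A, V] : EKConfig 2 N) ν)⁻¹ * ((![A, V] : EKConfig 2 N) μ)⁻¹ * (![A, V] : EKConfig 2 N) ν *
        (![A, V] : EKConfig 2 N) μ := by
  have h1 : D⁻¹ * V * D = V := by
    rw [mul_assoc, ← h, ← mul_assoc, inv_mul_cancel, one_mul]
  have h2 : D⁻¹ * V⁻¹ * D = V⁻¹ := by
    have : D⁻¹ * V⁻¹ * D = (D⁻¹ * V * D)⁻¹ := by group
    rw [this, h1]
  revert μ ν
  simp only [Fin.forall_fin_two, Matrix.cons_val_zero, Matrix.cons_val_one]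
  refine ⟨⟨by group, ?_⟩, ?_, trivial⟩
  · calc V⁻¹ * (D * A)⁻¹ * V * (D * A) = V⁻¹ * A⁻¹ * (D⁻¹ * V * D) * A := by group
      _ = V⁻¹ * A⁻¹ * V * A := by rw [h1]
  · calc (D * A)⁻¹ * V⁻¹ * (D * A) * V = A⁻¹ * (D⁻¹ * V⁻¹ * D) * A * V := by group
      _ = A⁻¹ * V⁻¹ * A * V := by rw [h2]

/-- A PLAQUETTE-DETERMINED weight on `U(N)²` (`w U = w U'` whenever all holonomies agree) is invariant under `V ↦ D V` for
`D` commuting with `A`. -/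
theorem weight_pair_mul_left_of_plaquette {w : EKConfig 2 N → ℝ}
    (hw : ∀ U U' : EKConfig 2 N,
      (∀ μ ν : Fin 2, (U ν)⁻¹ * (U μ)⁻¹ * U ν * U μ = (U' ν)⁻¹ * (U' μ)⁻¹ * U' ν * U' μ) → w U = w U')
    (A V D : UN N) (h : D * A = A * D) :
    w ![A, D * V] = w ![A, V] :=
  hw _ _ (holonomy_pair_mul_left A V D h)

/-- A plaquette-determined weight on `U(N)²` is invariant under `A ↦ D A` for `D` commuting with `V`. -/
theorem weight_pair_mul_right_of_plaquette {w : EKConfig 2 N → ℝ}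
    (hw : ∀ U U' : EKConfig 2 N,
      (∀ μ ν : Fin 2, (U ν)⁻¹ * (U μ)⁻¹ * U ν * U μ = (U' ν)⁻¹ * (U' μ)⁻¹ * U' ν * U' μ) → w U = w U')
    (A V D : UN N) (h : D * V = V * D) :
    w ![D * A, V] = w ![A, V] :=
  hw _ _ (holonomy_pair_mul_right A V D h)

/-! ### §2  The `d = 2` engine for an arbitrary weight invariant under commuting left factors -/

/-- **One-link inequality at fixed first link, general weight.**  For a continuous `w ≥ 0` on `U(N)²` with
`w(A, DV) = w(A, V)` whenever `DA = AD`: `∫ w(A,V) |tr V|² dV ≤ N ∫ w(A,V) dV` for EVERY `A` (diagonalise `A = PΛP⁻¹`,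
take `D = P S_i P⁻¹`, apply `integral_mul_norm_sq_trace_le`). -/
theorem integral_pair_mul_norm_sq_trace_le_of_inv {w : EKConfig 2 N → ℝ} (hwc : Continuous w) (hw0 : ∀ U, 0 ≤ w U)
    (hw : ∀ A V D : UN N, D * A = A * D → w ![A, D * V] = w ![A, V]) (A : UN N) :
    ∫ V, w (![A, V] : EKConfig 2 N) * ‖Matrix.trace (V : Matrix (Fin N) (Fin N) ℂ)‖ ^ 2 ∂haarUN N ≤
      N * ∫ V, w (![A, V] : EKConfig 2 N) ∂haarUN N := by
  obtain ⟨P, hP⟩ := exists_conj_mem_diagonalTorus A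
  refine integral_mul_norm_sq_trace_le P (hwc.comp (continuous_pair A)) (fun V => hw0 _) fun i V => ?_
  exact hw A V _ (conj_rowSign_mul_comm hP i)

/-- **Pointwise (first-link) inequality, general weight**: `∫ |tr V/N|² w(A,V) dV ≤ (1/N) ∫ w(A,V) dV` for every `A`. -/
theorem integral_pair_le_of_inv (hN : 0 < N) {w : EKConfig 2 N → ℝ} (hwc : Continuous w) (hw0 : ∀ U, 0 ≤ w U)
    (hw : ∀ A V D : UN N, D * A = A * D → w ![A, D * V] = w ![A, V]) (A : UN N) :
    ∫ V, ‖openLine 1 (![A, V] : EKConfig 2 N)‖ ^ 2 * w (![A, V] : EKConfig 2 N) ∂haarUN N ≤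
      1 / (N : ℝ) * ∫ V, w (![A, V] : EKConfig 2 N) ∂haarUN N := by
  have hN' : (0 : ℝ) < N := Nat.cast_pos.2 hN
  have hsq : ∀ V : UN N, ‖openLine 1 (![A, V] : EKConfig 2 N)‖ ^ 2 * w (![A, V] : EKConfig 2 N) =
      (1 / (N : ℝ) ^ 2) * (w (![A, V] : EKConfig 2 N) * ‖Matrix.trace (V : Matrix (Fin N) (Fin N) ℂ)‖ ^ 2) := by
    intro V
    rw [openLine_one_pair, norm_div, Complex.norm_natCast, div_pow]
    ring
  simp_rw [hsq]
  rw [integral_const_mul]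
  calc 1 / (N : ℝ) ^ 2 * ∫ V, w (![A, V] : EKConfig 2 N) * ‖Matrix.trace (V : Matrix (Fin N) (Fin N) ℂ)‖ ^ 2 ∂haarUN N
      ≤ 1 / (N : ℝ) ^ 2 * (N * ∫ V, w (![A, V] : EKConfig 2 N) ∂haarUN N) :=
        mul_le_mul_of_nonneg_left (integral_pair_mul_norm_sq_trace_le_of_inv hwc hw0 hw A) (by positivity)
    _ = 1 / (N : ℝ) * ∫ V, w (![A, V] : EKConfig 2 N) ∂haarUN N := one_div_sq_mul_mul hN'.ne' _

/-- **Direction `1`, general weight.**  For `d = 2`, `N ≥ 1` and every continuous `w ≥ 0` on `U(N)²` with `w(A, DV) = w(A, V)`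
whenever `DA = AD`: `∫ |tr U₁/N|² w ≤ (1/N) ∫ w` (Fubini over the first link + the pointwise inequality). -/
theorem integral_normSq_openLine_one_mul_le_of_inv (hN : 0 < N) {w : EKConfig 2 N → ℝ} (hwc : Continuous w)
    (hw0 : ∀ U, 0 ≤ w U) (hw : ∀ A V D : UN N, D * A = A * D → w ![A, D * V] = w ![A, V]) :
    ∫ U, ‖openLine 1 U‖ ^ 2 * w U ∂ekHaar 2 N ≤ 1 / (N : ℝ) * ∫ U, w U ∂ekHaar 2 N := by
  have hc₁ : Continuous fun U : EKConfig 2 N => ‖openLine 1 U‖ ^ 2 * w U :=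
    ((continuous_openLine (d := 2) (N := N) 1).norm.pow 2).mul hwc
  -- integrands passed EXPLICITLY (no higher-order unification against `![A, V]`)
  have h1 := integral_ekHaar_two (fun U : EKConfig 2 N => ‖openLine 1 U‖ ^ 2 * w U) hc₁
  have h2 := integral_ekHaar_two (fun U : EKConfig 2 N => w U) hwc
  have hf := integrable_integral_pair (fun U : EKConfig 2 N => ‖openLine 1 U‖ ^ 2 * w U) hc₁
  have hg := (integrable_integral_pair (fun U : EKConfig 2 N => w U) hwc).const_mul (1 / (N : ℝ))
  have hfg := integral_mono hf hg fun A => integral_pair_le_of_inv hN hwc hw0 hw A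
  have h3 := integral_const_mul (μ := haarUN N) (1 / (N : ℝ))
    (fun A : UN N => ∫ V, w (![A, V] : EKConfig 2 N) ∂haarUN N)
  calc ∫ U, ‖openLine 1 U‖ ^ 2 * w U ∂ekHaar 2 N
      = ∫ A, (∫ V, ‖openLine 1 (![A, V] : EKConfig 2 N)‖ ^ 2 * w (![A, V] : EKConfig 2 N) ∂haarUN N) ∂haarUN N := h1
    _ ≤ ∫ A, 1 / (N : ℝ) * (∫ V, w (![A, V] : EKConfig 2 N) ∂haarUN N) ∂haarUN N := hfg
    _ = 1 / (N : ℝ) * ∫ A, (∫ V, w (![A, V] : EKConfig 2 N) ∂haarUN N) ∂haarUN N := h3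
    _ = 1 / (N : ℝ) * ∫ U, w U ∂ekHaar 2 N := congrArg (fun z : ℝ => 1 / (N : ℝ) * z) h2.symm

/-- Relabelling the directions is continuous. -/
theorem continuous_relabel {d : ℕ} (σ : Equiv.Perm (Fin d)) : Continuous fun U : EKConfig d N => relabel σ U :=
  continuous_pi fun μ => continuous_apply (σ μ)

/-- **Direction `0`, general weight.**  For `d = 2`, `N ≥ 1` and every continuous `w ≥ 0` on `U(N)²` with `w(DA, V) = w(A, V)`
whenever `DV = VD`: `∫ |tr U₀/N|² w ≤ (1/N) ∫ w` (the direction-`1` statement for `w ∘ swap`, transported by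
`measurePreserving_relabelEquiv`). -/
theorem integral_normSq_openLine_zero_mul_le_of_inv (hN : 0 < N) {w : EKConfig 2 N → ℝ} (hwc : Continuous w)
    (hw0 : ∀ U, 0 ≤ w U) (hw : ∀ A V D : UN N, D * V = V * D → w ![D * A, V] = w ![A, V]) :
    ∫ U, ‖openLine 0 U‖ ^ 2 * w U ∂ekHaar 2 N ≤ 1 / (N : ℝ) * ∫ U, w U ∂ekHaar 2 N := by
  set σ : Equiv.Perm (Fin 2) := Equiv.swap (0 : Fin 2) 1 with hσ
  have hmp := measurePreserving_relabelEquiv (N := N) (d := 2) σ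
  have hwc' : Continuous fun U : EKConfig 2 N => w (relabel σ U) := hwc.comp (continuous_relabel σ)
  have hw' : ∀ A V D : UN N, D * A = A * D →
      (fun U : EKConfig 2 N => w (relabel σ U)) ![A, D * V] = (fun U : EKConfig 2 N => w (relabel σ U)) ![A, V] := by
    intro A V D h
    simp only [hσ, relabel_swap_pair]
    exact hw V A D h
  have key := integral_normSq_openLine_one_mul_le_of_inv hN hwc' (fun U => hw0 _) hw'
  have e1 : ∫ U, ‖openLine 0 U‖ ^ 2 * w U ∂ekHaar 2 N = ∫ U, ‖openLine 1 U‖ ^ 2 * w (relabel σ U) ∂ekHaar 2 N := by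
    rw [← hmp.integral_comp']
    refine integral_congr_ae (Eventually.of_forall fun U => ?_)
    simp only [coe_relabelEquiv, openLine_relabel, hσ, Equiv.swap_apply_left]
  have e2 : ∫ U, w U ∂ekHaar 2 N = ∫ U, w (relabel σ U) ∂ekHaar 2 N := by
    rw [← hmp.integral_comp']
    simp only [coe_relabelEquiv]
  rw [e1, e2]
  exact key

/-! ### §3  Plaquette-determined weights: both directions -/

/-- **No centre-symmetry breaking in `d = 2` for ANY plaquette-determined single-site action.**  For `d = 2`, every `N ≥ 1`,
both directions `μ` and every continuous weight `w ≥ 0` on `U(N)²` that depends on the configuration only through its plaquette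
holonomies `U_ν⁻¹ U_μ⁻¹ U_ν U_μ`:  `∫ |(1/N) tr U_μ|² w dU ≤ (1/N) ∫ w dU`.  Covers the Wilson weight (14.40) at every real
coupling (`ekOrderParameter_two_le`), the twisted action `tekAction z` for every twist, and any adjoint / mixed / heat-kernel
one-plaquette weight. -/
theorem integral_normSq_openLine_mul_le_of_plaquette (hN : 0 < N) {w : EKConfig 2 N → ℝ} (hwc : Continuous w)
    (hw0 : ∀ U, 0 ≤ w U)
    (hw : ∀ U U' : EKConfig 2 N,
      (∀ μ ν : Fin 2, (U ν)⁻¹ * (U μ)⁻¹ * U ν * U μ = (U' ν)⁻¹ * (U' μ)⁻¹ * U' ν * U' μ) → w U = w U')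
    (μ : Fin 2) :
    ∫ U, ‖openLine μ U‖ ^ 2 * w U ∂ekHaar 2 N ≤ 1 / (N : ℝ) * ∫ U, w U ∂ekHaar 2 N := by
  revert μ
  rw [Fin.forall_fin_two]
  exact ⟨integral_normSq_openLine_zero_mul_le_of_inv hN hwc hw0 (weight_pair_mul_right_of_plaquette hw),
    integral_normSq_openLine_one_mul_le_of_inv hN hwc hw0 (weight_pair_mul_left_of_plaquette hw)⟩

/-- A continuous, everywhere positive weight has positive total mass for the a-priori measure `∏_μ dU_μ`. -/
theorem integral_pos_of_continuous_pos {d : ℕ} {w : EKConfig d N → ℝ} (hwc : Continuous w) (hpos : ∀ U, 0 < w U) :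
    0 < ∫ U, w U ∂ekHaar d N := by
  have h : (fun U : EKConfig d N => Real.exp (Real.log (w U))) = w := funext fun U => Real.exp_log (hpos U)
  have hi : Integrable (fun U : EKConfig d N => Real.exp (Real.log (w U))) (ekHaar d N) := by
    rw [h]; exact integrable_of_continuous_config hwc
  rw [← h]
  exact integral_exp_pos hi

/-- **Ratio form.**  For `d = 2`, `N ≥ 1` and every continuous, everywhere positive, plaquette-determined weight:
the open-line order parameter `⟨|(1/N) tr U_μ|²⟩_w = (∫ |tr U_μ/N|² w)/(∫ w)` is at most `1/N`. -/
theorem openLine_ratio_le_of_plaquette (hN : 0 < N) {w : EKConfig 2 N → ℝ} (hwc : Continuous w) (hpos : ∀ U, 0 < w U)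
    (hw : ∀ U U' : EKConfig 2 N,
      (∀ μ ν : Fin 2, (U ν)⁻¹ * (U μ)⁻¹ * U ν * U μ = (U' ν)⁻¹ * (U' μ)⁻¹ * U' ν * U' μ) → w U = w U')
    (μ : Fin 2) :
    (∫ U, ‖openLine μ U‖ ^ 2 * w U ∂ekHaar 2 N) / (∫ U, w U ∂ekHaar 2 N) ≤ 1 / N := by
  rw [div_le_iff₀ (integral_pos_of_continuous_pos hwc hpos)]
  exact integral_normSq_openLine_mul_le_of_plaquette hN hwc (fun U => (hpos U).le) hw μ

end TwoDim

/-! ### §4  The twisted Eguchi–Kawai action in `d = 2`: centre symmetric for every twist and every coupling -/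

variable {N : ℕ}

/-- The twisted reduced action `S_TEK` depends continuously on the configuration. -/
theorem continuous_tekAction {d : ℕ} (z : Fin d → Fin d → ℂ) : Continuous fun U : EKConfig d N => tekAction z U := by
  unfold tekAction
  refine continuous_finsetSum _ fun μ _ => continuous_finsetSum _ fun ν _ => ?_
  split_ifs
  · exact continuous_const
  · exact (continuous_const.sub
      ((Complex.continuous_re.comp (continuous_const.mul (continuous_ekPlaqTrace μ ν))).div_const _)).div_const _

/-- **The twisted action is plaquette-determined** (any `d`, any twist): it is a function of the plaquette traces
`tr(U_ν⁻¹ U_μ⁻¹ U_ν U_μ)` (`ekPlaqTrace_eq_trace_coe`), hence of the holonomies. -/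
theorem tekAction_eq_of_holonomy_eq {d : ℕ} (z : Fin d → Fin d → ℂ) {U U' : EKConfig d N}
    (h : ∀ μ ν : Fin d, (U ν)⁻¹ * (U μ)⁻¹ * U ν * U μ = (U' ν)⁻¹ * (U' μ)⁻¹ * U' ν * U' μ) :
    tekAction z U = tekAction z U' := by
  unfold tekAction
  simp_rw [ekPlaqTrace_eq_trace_coe, h]

/-- The twisted Boltzmann weight `e^{−N² b S_TEK}` is continuous. -/
theorem continuous_tekWeight {d : ℕ} (z : Fin d → Fin d → ℂ) (b : ℝ) :
    Continuous fun U : EKConfig d N => Real.exp (-((N : ℝ) ^ 2 * b) * tekAction z U) :=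
  Real.continuous_exp.comp (continuous_const.mul (continuous_tekAction z))

/-- The twisted partition function `Z_TEK = ∫ e^{−N² b S_TEK} ∏ dU_μ` is positive (any `d`, twist, coupling). -/
theorem tekPartition_pos {d : ℕ} (z : Fin d → Fin d → ℂ) (b : ℝ) :
    0 < ∫ U, Real.exp (-((N : ℝ) ^ 2 * b) * tekAction z U) ∂ekHaar d N :=
  TwoDim.integral_pos_of_continuous_pos (continuous_tekWeight z b) fun _ => Real.exp_pos _

/-- **Twisted EK in `d = 2`: numerator `≤` partition function`/N`.**  For every twist matrix `z` (no unit-modulus or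
antisymmetry assumption), every real coupling `b`, every `N ≥ 1` and both directions:
`∫ |(1/N) tr U_μ|² e^{−N² b S_TEK[U]} dU ≤ (1/N) ∫ e^{−N² b S_TEK[U]} dU`. -/
theorem tek_integral_normSq_openLine_mul_le (z : Fin 2 → Fin 2 → ℂ) (hN : 0 < N) (b : ℝ) (μ : Fin 2) :
    ∫ U, ‖openLine μ U‖ ^ 2 * Real.exp (-((N : ℝ) ^ 2 * b) * tekAction z U) ∂ekHaar 2 N ≤
      1 / (N : ℝ) * ∫ U, Real.exp (-((N : ℝ) ^ 2 * b) * tekAction z U) ∂ekHaar 2 N :=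
  TwoDim.integral_normSq_openLine_mul_le_of_plaquette hN (continuous_tekWeight z b) (fun U => (Real.exp_pos _).le)
    (fun _ _ h => by rw [tekAction_eq_of_holonomy_eq z h]) μ

/-- **The `d = 2` twisted Eguchi–Kawai model is centre symmetric at EVERY coupling and for EVERY twist, quantitatively at
finite `N`**: the open-line order parameter `⟨|(1/N) tr U_μ|²⟩_TEK = (∫ |tr U_μ/N|² e^{−N²bS_TEK})/(∫ e^{−N²bS_TEK})` is at most
`1/N` (`N ≥ 1`, both `μ`, all `z`, all `b ∈ ℝ`).  With `z ≡ 1` this is `ekOrderParameter_two_le` (`tekAction_one`). -/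
theorem tekOrderParameter_two_le (z : Fin 2 → Fin 2 → ℂ) (hN : 0 < N) (b : ℝ) (μ : Fin 2) :
    (∫ U, ‖openLine μ U‖ ^ 2 * Real.exp (-((N : ℝ) ^ 2 * b) * tekAction z U) ∂ekHaar 2 N) /
        (∫ U, Real.exp (-((N : ℝ) ^ 2 * b) * tekAction z U) ∂ekHaar 2 N) ≤ 1 / N :=
  TwoDim.openLine_ratio_le_of_plaquette hN (continuous_tekWeight z b) (fun U => Real.exp_pos _)
    (fun _ _ h => by rw [tekAction_eq_of_holonomy_eq z h]) μ

/-- The twisted order parameter is non-negative. -/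
theorem tekOrderParameter_nonneg {d : ℕ} (z : Fin d → Fin d → ℂ) (b : ℝ) (μ : Fin d) :
    0 ≤ (∫ U, ‖openLine μ U‖ ^ 2 * Real.exp (-((N : ℝ) ^ 2 * b) * tekAction z U) ∂ekHaar d N) /
        (∫ U, Real.exp (-((N : ℝ) ^ 2 * b) * tekAction z U) ∂ekHaar d N) :=
  div_nonneg (integral_nonneg fun U => mul_nonneg (by positivity) (Real.exp_pos _).le) (tekPartition_pos z b).le

/-- **The reduction hypothesis of the TWISTED model holds in `d = 2` for every twist family and every coupling family**:
for ANY `N`-dependent twists `z_N` (e.g. the symmetric twist `e^{2πik/L}`, `N = L²`, of González-Arroyo–Okawa) and ANY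
`N`-dependent real couplings `b_N`, the `d = 2` open-line order parameter `⟨|(1/N) tr U_μ|²⟩_TEK` tends to `0` as `N → ∞`
(it is `≤ 1/N`).  Evasion (b) of the barrier entry is thus idle in two dimensions: twisting can matter only for `d ≥ 3`. -/
theorem tekOpenLines_tendsto_zero_two (z : ℕ → Fin 2 → Fin 2 → ℂ) (b : ℕ → ℝ) (μ : Fin 2) :
    Tendsto (fun N : ℕ =>
      (∫ U, ‖openLine μ U‖ ^ 2 * Real.exp (-((N : ℝ) ^ 2 * b N) * tekAction (z N) U) ∂ekHaar 2 N) /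
        (∫ U, Real.exp (-((N : ℝ) ^ 2 * b N) * tekAction (z N) U) ∂ekHaar 2 N)) atTop (𝓝 0) := by
  refine tendsto_of_tendsto_of_tendsto_of_le_of_le' tendsto_const_nhds tendsto_one_div_atTop_nhds_zero_nat ?_ ?_
  · exact Eventually.of_forall fun N => tekOrderParameter_nonneg (z N) (b N) μ
  · filter_upwards [eventually_gt_atTop 0] with N hN
    exact tekOrderParameter_two_le (z N) hN (b N) μ

end Summit.QuantumFields.YangMills.Theorems.EguchiKawaiDirectionLadder

end
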